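import Summits.HubbardSuperconductivity.HubbardSuperconductivity.Theorems.AnisotropyChordTransferFibre3FinXDCheck

/-!
# Route `AnisotropyChord` / H0 rotor rung: FIN per-`L` row-D (KT-2a″) SUB-CELL facts, `L = 10` (36–41)

Row-D facts `xdCellAny0 10 (49/50) la lb aD = true` on quarter sub-cells of the combined cells whose side condition needs `aD ≈ .04` (mechhunt STATUS p3 g7 REPORT 3).
Prover seat `hubbard-h0-rotor-p3` g7; helper for piece A = stmt-HubbardSuperconductivity-23918 of rung 19089 (`--supports`, helper class).
WHAT THIS IS NOT: nothing here proves superconductivity in the Hubbard model (rotor TARGET as worded stays FALSE, g15 verdict); kernel facts /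
assembly for ONE conditional reduction at one `L`.  No sorry.
-/

set_option linter.dupNamespace false
set_option autoImplicit false

namespace Summit.HubbardSuperconductivity.HubbardSuperconductivity.Theorems.AnisotropyChord.Transfer.Fibre3

namespace FinXD

/-- row-D sub-cell `[17327726403765325, 17436024693788858]` of `L = 10`. [folklore] -/
theorem xd10s_138_0 : xdCellAny0 10 (49/50 : ℚ) 17327726403765325 17436024693788858 (1/25 : ℚ) = true := by decide +kernel

/-- row-D sub-cell `[17436024693788858, 17544322983812391]` of `L = 10`. [folklore] -/
theorem xd10s_138_1 : xdCellAny0 10 (49/50 : ℚ) 17436024693788858 17544322983812391 (1/25 : ℚ) = true := by decide +kernel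

/-- row-D sub-cell `[17544322983812391, 17652621273835924]` of `L = 10`. [folklore] -/
theorem xd10s_138_2 : xdCellAny0 10 (49/50 : ℚ) 17544322983812391 17652621273835924 (1/25 : ℚ) = true := by decide +kernel

/-- row-D sub-cell `[17652621273835924, 17760919563859457]` of `L = 10`. [folklore] -/
theorem xd10s_138_3 : xdCellAny0 10 (49/50 : ℚ) 17652621273835924 17760919563859457 (1/25 : ℚ) = true := by decide +kernel

/-- row-D sub-cell `[17760919563859457, 17871925311133578]` of `L = 10`. [folklore] -/
theorem xd10s_139_0 : xdCellAny0 10 (49/50 : ℚ) 17760919563859457 17871925311133578 (1/25 : ℚ) = true := by decide +kernel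

/-- row-D sub-cell `[17871925311133578, 17982931058407699]` of `L = 10`. [folklore] -/
theorem xd10s_139_1 : xdCellAny0 10 (49/50 : ℚ) 17871925311133578 17982931058407699 (1/25 : ℚ) = true := by decide +kernel

end FinXD

end Summit.HubbardSuperconductivity.HubbardSuperconductivity.Theorems.AnisotropyChord.Transfer.Fibre3
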